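import Mathlib
import Summits.ResolutionOfSingularities.ResolutionOfSingularities.Theorems.WildQuotientsWildQuotientResolutionJordanFiveTwistedChart
import Summits.ResolutionOfSingularities.ResolutionOfSingularities.Theorems.WildQuotientsWildQuotientResolutionJordanFiveFrameDefs

/-!
# R-T rung (J₅) — T5-iv: the generators of `I₁₂` on the universal twisted chart: `ψ₅(g_j) = l¹² · q_j`, and `I₁₂ · k[l,A,ξ,η₁,η₂] = (l¹²)`

(crux stmt-ResolutionOfSingularities-15640 `WildQuotients.WildQuotientResolution`, line `Sketch`;
chain w45c RUNG V5 (`L/w45c/CHAIN.md` v8.1; res-L1-w45c-plan-1 RULING 10:50Z: HP₁ = stub-1), over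
res-L1-w45c-lead-1's generator vector of record `JordanFive.gens12 : Fin 40 → k[x]` /
`JordanFive.exps12` / `JordanFive.I12` (p523816). Twin of J₄'s T-iv (`JordanFour.twistedChart_I6`,
`map_twistedChart_span_I6`, p499653). [OURS · L1 W4.5c] — NOT a statement of any manuscript
(Hironaka 2017 is consumed nowhere); replaces the role of no printed item. Prover res-L1-w45c-stub-1.
AI-written Lean, kernel-checked; weaker than expert review.)

Slots `l = X b`, `A = X a`, `ξ = X c`, `η₁ = X d`, `η₂ = X e`; `ψ₅ = JordanFive.twistedChart`,
`P = JordanFour.twistedP`, `D = JordanFive.twistedD`. Since `ψ₅(x_a) = l⁴A`, `ψ₅(x_b) = l³(1 + Aξ)`,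
`ψ₅(x_c) = l²P`, `ψ₅(x_d) = l·(D/6)`, a monomial `x_a^α x_b^β x_c^γ x_d^δ` of `(4,3,2,1)`-weight
`w = 4α + 3β + 2γ + δ ≥ 12` maps to `l¹² · q`, `q = l^{w−12} A^α (1+Aξ)^β P^γ (D/6)^δ`:
* `JordanFive.twistedCofactor12 j` — the `q`-VECTOR OF RECORD for `gens12` (this formula read off
  `exps12 j`); `twistedCofactor12_zero = A³`, `twistedCofactor12_one = (1 + Aξ)⁴`;
* `JordanFive.twistedChart_gens12 : ψ₅ (gens12 j) = X b ^ 12 * twistedCofactor12 j` (all `40` `j`);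
* `JordanFive.isCoprime_twistedCofactor12_zero_one` (`A³` and `(1+Aξ)⁴` are coprime) and
  **`JordanFive.map_twistedChart_I12 : I₁₂.map ψ₅ = (X b ^ 12)`** — `ψ₅` lifts to `Bl_{I₁₂} 𝔸ⁿ` with
  exceptional divisor `{l = 0}`;
* `JordanFive.twistedChart_mSlice : ψ₅(M) = ξ·l⁵·Q` (the closed form behind
  `X_b_mul_twistedChart_mSlice`, cancelling `l`).
-/

-- single-problem summit: the doubled namespace component `ResolutionOfSingularities` is forced
set_option linter.dupNamespace false

noncomputable section

open MvPolynomial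

namespace Summit.ResolutionOfSingularities.ResolutionOfSingularities.Theorems.WildQuotientResolution.JordanFive

section Defs

variable (k : Type) [Field k] (n : ℕ) (a b c d : Fin n)

/-- **The `q`-vector of record of `I₁₂` on the universal twisted chart**: for `gens12 j =
x_a^α x_b^β x_c^γ x_d^δ` (`(α,β,γ,δ) = exps12 j`, weight `w = 4α+3β+2γ+δ`),
`q_j = l^{w−12} · A^α · (1 + Aξ)^β · P^γ · (D/6)^δ`, so that `ψ₅(g_j) = l¹² q_j`. [OURS · L1 W4.5c] -/
def twistedCofactor12 (j : Fin 40) : MvPolynomial (Fin n) k :=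
  X b ^ (4 * (exps12 j).1 + 3 * (exps12 j).2.1 + 2 * (exps12 j).2.2.1 + (exps12 j).2.2.2 - 12) *
    X a ^ (exps12 j).1 * (1 + X a * X c) ^ (exps12 j).2.1 *
    JordanFour.twistedP k n a b c d ^ (exps12 j).2.2.1 *
    (C (6⁻¹ : k) * twistedD k n a b c d) ^ (exps12 j).2.2.2

/-- `q₀ = A³` (the `μ₄`-vertex generator `x_a³`). [OURS · L1 W4.5c] -/
theorem twistedCofactor12_zero : twistedCofactor12 k n a b c d 0 = X a ^ 3 := by
  simp [twistedCofactor12, exps12]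

/-- `q₁ = (1 + Aξ)⁴` (the `μ₃`-vertex generator `x_b⁴`). [OURS · L1 W4.5c] -/
theorem twistedCofactor12_one : twistedCofactor12 k n a b c d 1 = (1 + X a * X c) ^ 4 := by
  simp [twistedCofactor12, exps12]

/-- **`q₀ = A³` and `q₁ = (1 + Aξ)⁴` are coprime** (`(−ξ)·A + 1·(1 + Aξ) = 1`). [OURS · L1 W4.5c] -/
theorem isCoprime_twistedCofactor12_zero_one :
    IsCoprime (twistedCofactor12 k n a b c d 0) (twistedCofactor12 k n a b c d 1) := by
  have h : IsCoprime (X a : MvPolynomial (Fin n) k) (1 + X a * X c) := ⟨-X c, 1, by ring⟩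
  rw [twistedCofactor12_zero, twistedCofactor12_one]
  exact h.pow

end Defs

section Identities

variable (k : Type) [Field k] (n : ℕ) (a b c d e : Fin n)
  (hab : a ≠ b) (hac : a ≠ c) (had : a ≠ d) (hbc : b ≠ c) (hbd : b ≠ d) (hcd : c ≠ d)

include hab hac had hbc hbd hcd in
/-- **T5-iv `ψ₅(g_j) = l¹² q_j`** for the `40` generators of `I₁₂` (vector of record `gens12`) and the
`q`-vector of record `twistedCofactor12`. [OURS · L1 W4.5c] -/
theorem twistedChart_gens12 (j : Fin 40) :
    twistedChart k n a b c d e (gens12 k n a b c d j) = X b ^ 12 * twistedCofactor12 k n a b c d j := by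
  rw [gens12_eq_monomial]
  simp only [map_mul, map_pow, twistedChart_X_a, twistedChart_X_b k n a b c d e hab,
    twistedChart_X_c k n a b c d e hac hbc, twistedChart_X_d k n a b c d e had hbd hcd,
    twistedCofactor12]
  fin_cases j <;> simp [exps12] <;> ring

include hab hac had hbc hbd hcd in
/-- **`I₁₂ · k[l, A, ξ, η₁, η₂] = (l¹²)`**: the extension of `I₁₂` along `ψ₅` is the principal ideal
`(X b ^ 12)` — so `ψ₅` lifts to the first floor `Bl_{I₁₂} 𝔸ⁿ`, with exceptional divisor `{l = 0}`.
[OURS · L1 W4.5c] -/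
theorem map_twistedChart_I12 :
    Ideal.map (twistedChart k n a b c d e) (I12 k n a b c d) =
      Ideal.span {(X b ^ 12 : MvPolynomial (Fin n) k)} := by
  apply le_antisymm
  · rw [I12, Ideal.map_span, Ideal.span_le]
    rintro _ ⟨_, ⟨j, rfl⟩, rfl⟩
    rw [SetLike.mem_coe, twistedChart_gens12 k n a b c d e hab hac had hbc hbd hcd j]
    exact Ideal.mul_mem_right _ _ (Ideal.subset_span rfl)
  · rw [Ideal.span_le, Set.singleton_subset_iff, SetLike.mem_coe]
    obtain ⟨u, v, huv⟩ := isCoprime_twistedCofactor12_zero_one k n a b c d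
    have h0 : X b ^ 12 * twistedCofactor12 k n a b c d 0 ∈
        Ideal.map (twistedChart k n a b c d e) (I12 k n a b c d) := by
      rw [← twistedChart_gens12 k n a b c d e hab hac had hbc hbd hcd 0]
      exact Ideal.mem_map_of_mem _ (gens12_mem_I12 k n a b c d 0)
    have h1 : X b ^ 12 * twistedCofactor12 k n a b c d 1 ∈
        Ideal.map (twistedChart k n a b c d e) (I12 k n a b c d) := by
      rw [← twistedChart_gens12 k n a b c d e hab hac had hbc hbd hcd 1]
      exact Ideal.mem_map_of_mem _ (gens12_mem_I12 k n a b c d 1)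
    have e' : (X b ^ 12 : MvPolynomial (Fin n) k) =
        u * (X b ^ 12 * twistedCofactor12 k n a b c d 0) +
          v * (X b ^ 12 * twistedCofactor12 k n a b c d 1) := by
      linear_combination (-(X b ^ 12 : MvPolynomial (Fin n) k)) * huv
    rw [e']
    exact Ideal.add_mem _ (Ideal.mul_mem_left _ _ h0) (Ideal.mul_mem_left _ _ h1)

include hab hac had hbc hbd hcd in
/-- **`ψ₅(M) = ξ·l⁵·Q`** (the slice `ξ = lM/H'` in closed form; `2, 3 ∈ kˣ`). [OURS · L1 W4.5c] -/
theorem twistedChart_mSlice (h2 : (2 : k) ≠ 0) (h3 : (3 : k) ≠ 0) :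
    twistedChart k n a b c d e (JordanFour.mSlice k n a b c d) =
      X c * X b ^ 5 * JordanFour.twistedQ k n a b d := by
  have hne : (X b : MvPolynomial (Fin n) k) ≠ 0 := X_ne_zero b
  refine mul_left_cancel₀ hne ?_
  rw [X_b_mul_twistedChart_mSlice k n a b c d e hab hac had hbc hbd hcd h2 h3]
  ring

end Identities

end Summit.ResolutionOfSingularities.ResolutionOfSingularities.Theorems.WildQuotientResolution.JordanFive

end
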